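import Mathlib
import Literature.AlgebraicGeometry.Resolution.CobordantGame
import Literature.AlgebraicGeometry.Resolution.CobordantChartCoefficients
import Summits.ResolutionOfSingularities.ResolutionOfSingularities.Theorems.WeightedInvariantLocalWeightedDropGradingDescent

/-!
# `WeightedInvariant.LocalWeightedDrop`, graded game: the successor is graded by the residues of the weights

Route `ResolutionOfSingularities/WeightedInvariant`, crux `LocalWeightedDrop`
(stmt-ResolutionOfSingularities-8899).  [OURS · L1 W4.3] — item R3-T2a `successor_graded` of ideator
res-L1-w43-idea-1's `Sketch-L1-idea-1.lean` v3 (sha16 `631198685223c190`, §5), with its two definitions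
`nuWeight`, `stabOrder` verbatim, PROVED here (res-L1-w43-plan-1 ORDER (o6) tail, CHAIN w43 v4.4.2).
Companion of `Theorems/WeightedInvariantLocalWeightedDropGradedGame.lean` (the graded game, p498029).
Nothing here is a statement of the manuscript under review on ladder RESOLUTION.

**Statement.**  In the setting of the crux — `F ∈ k[[x₁..xₙ]]`, weights `w`, exceptional point `c`, the
literal chart `CobordantGame.cruxChart k w c : xᵢ ↦ s^{wᵢ}(cᵢ + yᵢ)` (`wᵢ > 0`) / `xᵢ ↦ yᵢ` (`wᵢ = 0`),
and a factorisation `F(chart_c) = sᵃ·g` — every monomial `s^{m₀} y^{(m₁..mₙ)}` of `g` has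
`ν`-weight `Σ wⱼ mⱼ₊₁ − m₀ ≡ a (mod G(c))`, where `G(c) = gcd {wⱼ : cⱼ ≠ 0 ∧ 0 < wⱼ}` is the order of
the stabiliser `μ_{G(c)}` of `c` in the old torus: `g` is a semi-invariant of the (possibly non-reduced)
stabiliser.  No hypothesis on `k`, `n`, `c` or the characteristic.

**Proof.**  This is the tree's GRADING DESCENT `Theorems.stub_gradingDescent`
(`WeightedInvariantLocalWeightedDropGradingDescent.lean`: `w·β ≡ a + r (mod D)` for every monomial
`s^r y^β` of `g` and every `D` dividing all `wᵢ` with `cᵢ ≠ 0`, stated for the chart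
`CobordantChart.chart w c` under the convention `cᵢ = 0` when `wᵢ = 0`), applied to the normalised point
`c'ᵢ = cᵢ` (`wᵢ > 0`) / `0` (`wᵢ = 0`) — `cruxChart k w c = chart w c'` by
`CobordantChart.cruxChart_eq_chart` — and to `D = G(c)`, which divides every `wⱼ` with `c'ⱼ ≠ 0`
(`Finset.gcd_dvd`); the congruence is then read in `ZMod G(c)`.
-/

set_option linter.dupNamespace false -- mandated namespace of this single-conjunct summit
set_option autoImplicit false

namespace Summit.ResolutionOfSingularities.ResolutionOfSingularities.Theorems

namespace GradedGame

open MvPowerSeries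
open Literature.AlgebraicGeometry.Resolution

variable {k : Type} [Field k]

/-- The character ("ν-weight") of the exponent `m` of `k[[s, y₁..yₙ]]` under the old torus:
`Σ wⱼ mⱼ₊₁ − m₀`. [OURS · L1 W4.3, Sketch-L1-idea-1 v3 §5] -/
def nuWeight {n : ℕ} (w : Fin n → ℕ) (m : Fin (n + 1) →₀ ℕ) : ℤ :=
  (∑ j : Fin n, (w j : ℤ) * (m j.succ : ℤ)) - (m 0 : ℤ)

/-- Order of the stabiliser of the exceptional point `c`: `G(c) = gcd {wⱼ : cⱼ ≠ 0 ∧ 0 < wⱼ}` (`0` if no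
such `j`). [OURS · L1 W4.3, Sketch-L1-idea-1 v3 §5] -/
noncomputable def stabOrder {n : ℕ} (w : Fin n → ℕ) (c : Fin n → k) : ℕ := by
  classical exact (Finset.univ.filter fun j => c j ≠ 0 ∧ 0 < w j).gcd w

/-- `G(c)` divides every weight `wⱼ` with `cⱼ ≠ 0 < wⱼ`. [OURS · L1 W4.3] -/
theorem stabOrder_dvd {n : ℕ} (w : Fin n → ℕ) (c : Fin n → k) (j : Fin n) (hc : c j ≠ 0)
    (hw : 0 < w j) : stabOrder w c ∣ w j := by
  classical
  unfold stabOrder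
  exact Finset.gcd_dvd (by simp [hc, hw])

/-- R3-T2a — THE SUCCESSOR IS GRADED BY THE RESIDUES OF THE WEIGHTS (all `n`, all characteristics).  If
`F(chart_c) = sᵃ·g` for the crux's literal chart at `c`, then every monomial of `g` has `ν`-weight
`≡ a (mod G(c))`: `g` is a semi-invariant of the (possibly non-reduced) stabiliser `μ_{G(c)}` of `c`.
Corollary of the tree's `stub_gradingDescent` at the normalised point and `D = G(c)`.
[OURS · L1 W4.3, Sketch-L1-idea-1 v3 §5, signature verbatim] -/
theorem successor_graded {n : ℕ} (F : MvPowerSeries (Fin n) k) (w : Fin n → ℕ) (c : Fin n → k) (a : ℕ)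
    (g : MvPowerSeries (Fin (n + 1)) k)
    (h : subst (CobordantGame.cruxChart k w c) F = X (0 : Fin (n + 1)) ^ a * g)
    (m : Fin (n + 1) →₀ ℕ) (hm : coeff m g ≠ 0) :
    ((nuWeight w m : ℤ) : ZMod (stabOrder w c)) = (a : ZMod (stabOrder w c)) := by
  classical
  -- normalise the point: `c'ᵢ = cᵢ` for `wᵢ > 0`, `0` otherwise; the literal chart is `chart w c'`
  set c' : Fin n → k := fun i => if 0 < w i then c i else 0 with hc'def
  have hcc : CobordantGame.cruxChart k w c = CobordantChart.chart w c' :=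
    CobordantChart.cruxChart_eq_chart w c
  rw [hcc] at h
  have hconv : ∀ i, w i = 0 → c' i = 0 := fun i hi => by simp [hc'def, hi]
  -- `G(c)` divides every weight on the support of `c'`
  have hD : ∀ i, c' i ≠ 0 → stabOrder w c ∣ w i := by
    intro i hi
    have hw : 0 < w i := by
      by_contra hw
      exact hi (by simp [hc'def, hw])
    have hci : c i ≠ 0 := by simpa [hc'def, hw] using hi
    exact stabOrder_dvd w c i hci hw
  -- grading descent: `w·(tail m) ≡ a + m 0 (mod G(c))`
  have key := stub_gradingDescent k n F w c' hconv a g h (stabOrder w c) hD m hm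
  rw [← ZMod.natCast_eq_natCast_iff, Finsupp.weight_apply,
    Finsupp.sum_fintype _ _ (fun _ => by simp), Nat.cast_sum] at key
  simp only [Finsupp.tail_apply, smul_eq_mul, Nat.cast_mul, Nat.cast_add] at key
  have key' : ∑ x : Fin n, ((w x : ℕ) : ZMod (stabOrder w c)) * ((m x.succ : ℕ) : ZMod (stabOrder w c))
      = (a : ZMod (stabOrder w c)) + ((m 0 : ℕ) : ZMod (stabOrder w c)) := by
    rw [← key]
    exact Finset.sum_congr rfl fun x _ => mul_comm _ _
  -- read `Σ wⱼ mⱼ₊₁ − m₀ = a` in `ZMod G(c)`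
  unfold nuWeight
  push_cast
  linear_combination key'

end GradedGame

end Summit.ResolutionOfSingularities.ResolutionOfSingularities.Theorems
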